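import Mathlib
import Summits.KontsevichZagierPeriods.Zeta5Search.RecordCellDAtlas
import Summits.KontsevichZagierPeriods.Zeta5Search.LevelClassDigits
import HarnessLib

/-!
# ζ(5) search — RECORD CELL D, digit layer: the minimal classes of the record ray at `7n < p < 7.5n`

Cell `pub-zeta5` (HONEST FRAMING: systematic search; no irrationality claim unless certified), P1 prover seat
generation 6; part 1 of the Lean proof of census g11's `CellAtlas.RecordCellD` (assembly in `RecordCellDProof.lean`).
For any parameter vector `b′` with `b′₀ = 41n` carrying the cell-D class data of `RecordCellDAtlas` on the minimal classes
(`b′ = b(n)` and `b′ = b(n) + e₇` both do), the normalised first digits of the minimal classes are TYPE CONSTANTS times the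
class unit (`LevelClassDigits`, from P1 g5's `wDigit`/`vDigit` = gen-2 g9's U-W/U-V, and G1/G2):
`p⁵W_x ≡ −ĝ_x·ŵ(T)`, `p⁸V_x ≡ ĝ_x·v̂(T) (mod p)`, the conjugate class `x̄ = 41n − (x+4p)` carrying the unit `−ĝ_x`
(`digits_of_type`).  Hence (`packT1`) every `MinT1/MinT2` pair contributes `p⁵(W_x+W_x̄) ≡ −α·ĝ_x`, `p⁸(V_x+V_x̄) ≡ β·ĝ_x`
with the SAME two closed constants `α = ŵ(T₁) − ŵ(T₂)` (`alphaD`), `β = v̂(T₁) − v̂(T₂)` (`betaD`) — never evaluated —, and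
(`packS`) the pair sums of the palindromic `MinS` classes VANISH modulo `p` (gen-2 g9's COROLLARY P(a), REPORT-gen2-g9 §1.6).
`p`-adic valuations of rational numbers; nothing about irrationality.  Exact cross-check of every congruence at the seven record
primes with `n ≤ 10`: `code/p1/g6/cellD_check.py` (independent partial-fraction kernel; `α = 41`, `β = −527/8` there).
-/

noncomputable section

open Finset

namespace Summit.KontsevichZagierPeriods.Zeta5Search.CellD

open Summit.KontsevichZagierPeriods.Zeta5Search.DualSeries (InBox)
open Summit.KontsevichZagierPeriods.Zeta5Search.WedgeDictionary (pfData coeffW coeffV)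
open Summit.KontsevichZagierPeriods.Zeta5Search.CasoratianValuation (InPolytope shift casoratian)
open Summit.KontsevichZagierPeriods.Zeta5Search.ClusterValuation
open Summit.KontsevichZagierPeriods.Zeta5Search.PadicSeries
open Summit.KontsevichZagierPeriods.Zeta5Search.BigPrime (shift_zero padicNorm_mul_le_one)
open Summit.KontsevichZagierPeriods.Zeta5Search.CellA
open Summit.KontsevichZagierPeriods.Zeta5Search.LevelClass

variable {p : ℕ} [hp : Fact p.Prime]

/-! ### §1 The three types and their constants -/

/-- Type `T₁ = (1,−1,−6,−3,1)`. -/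
def eT1 : ℕ → ℤ
  | 0 => 1 | 1 => -1 | 2 => -6 | 3 => -3 | 4 => 1 | _ => 0

/-- Type `T₂ = (1,−3,−6,−1,1)` (reverse of `T₁`). -/
def eT2 : ℕ → ℤ
  | 0 => 1 | 1 => -3 | 2 => -6 | 3 => -1 | 4 => 1 | _ => 0

/-- The palindromic type `S = (1,−2,−6,−2,1)`. -/
def eS : ℕ → ℤ
  | 0 => 1 | 1 => -2 | 2 => -6 | 3 => -2 | 4 => 1 | _ => 0

/-- `α = ŵ(T₁) − ŵ(T₂)` (a closed rational constant; never evaluated). -/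
def alphaD : ℚ := typeW 4 eT1 - typeW 4 eT2

/-- `β = v̂(T₁) − v̂(T₂)` (a closed rational constant; never evaluated). -/
def betaD : ℚ := typeV 4 eT1 - typeV 4 eT2

/-- `E(T₁) = −8`. -/
theorem typeExp_eT1 : typeExp 4 eT1 = -8 := by decide
/-- `E(T₂) = −8`. -/
theorem typeExp_eT2 : typeExp 4 eT2 = -8 := by decide
/-- `E(S) = −8`. -/
theorem typeExp_eS : typeExp 4 eS = -8 := by decide

omit hp in
/-- `(−p)^{−(−8+3)} = −p⁵`. -/
theorem negp_zpow_five : (-(p : ℚ)) ^ (-((-8 : ℤ) + 3)) = -(p : ℚ) ^ 5 := by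
  rw [show (-((-8 : ℤ) + 3)) = ((5 : ℕ) : ℤ) by norm_num, zpow_natCast]; ring

omit hp in
/-- `(−p)^{−(−8)} = p⁸`. -/
theorem negp_zpow_eight : (-(p : ℚ)) ^ (-(-8 : ℤ)) = (p : ℚ) ^ 8 := by
  rw [show (-(-8 : ℤ)) = ((8 : ℕ) : ℤ) by norm_num, zpow_natCast]; ring

/-- `(−1)^{−8+1} = −1`. -/
theorem neg_one_zpow_m7 : (-1 : ℚ) ^ ((-8 : ℤ) + 1) = -1 := by
  rw [show ((-8 : ℤ) + 1) = -(7 : ℕ) by norm_num, zpow_neg, zpow_natCast]; norm_num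

omit hp in
/-- Five point values as a level exponent vector. -/
theorem he_of_five {b : ℕ → ℤ} {x : ℕ} {e : ℕ → ℤ} (h0 : netExp b x = e 0) (h1 : netExp b (x + p) = e 1)
    (h2 : netExp b (x + 2 * p) = e 2) (h3 : netExp b (x + 3 * p) = e 3) (h4 : netExp b (x + 4 * p) = e 4) :
    ∀ k ≤ 4, netExp b (x + k * p) = e k := by
  intro k hk
  interval_cases k
  · simpa using h0
  · simpa using h1
  · exact h2
  · exact h3
  · exact h4

/-! ### §2 The minimal classes for any `b′` with the cell-D class data (`b′ = b(n)` or `b(n) + e₇`) -/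

section MinBlock

variable {n : ℕ} (hp14 : 14 * n < 2 * p) (hp15 : 2 * p < 15 * n) (hp5 : 5 ≤ p)
  (b : ℕ → ℤ) (hb : InPolytope b) (hwin : (b 0 + 2 : ℤ) < (p : ℤ) ^ 2) (hN : (b 0).toNat = 41 * n)
  (hcen : ∀ x, x < p → 2 * x + 4 * p ≠ 41 * n → 2 * x + 5 * p ≠ 41 * n → ¬ CentreIn b p x)
  (hT1 : ∀ x ∈ MinT1 n p, netExp b x = 1 ∧ netExp b (x + p) = -1 ∧ netExp b (x + 2 * p) = -6 ∧
      netExp b (x + 3 * p) = -3 ∧ netExp b (x + 4 * p) = 1)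
  (hS : ∀ x ∈ MinS n p, netExp b x = 1 ∧ netExp b (x + p) = -2 ∧ netExp b (x + 2 * p) = -6 ∧
      netExp b (x + 3 * p) = -2 ∧ netExp b (x + 4 * p) = 1)
  (hT2 : ∀ x ∈ MinT2 n p, netExp b x = 1 ∧ netExp b (x + p) = -3 ∧ netExp b (x + 2 * p) = -6 ∧
      netExp b (x + 3 * p) = -1 ∧ netExp b (x + 4 * p) = 1)

include hp5 hb hwin hN hcen in
/-- The digits of ONE minimal class of type `e` (`E(e) = −8`): `‖p⁵W_x + g·ŵ(e)‖ ≤ p⁻¹`, `‖p⁸V_x − g·v̂(e)‖ ≤ p⁻¹` for any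
`g ≡ ĝ_x`, the integrality of `p⁵W_x`, `p⁸V_x`, `ŵ(e)`, and the conjugate unit `‖ĝ_{41n−(x+4p)} + ĝ_x‖ ≤ p⁻¹`. -/
theorem digits_of_type {x : ℕ} (hx : x < p) (h4 : x + 4 * p ≤ 41 * n) (h5 : 41 * n < x + 5 * p)
    (hc4 : 2 * x + 4 * p ≠ 41 * n) (hc5 : 2 * x + 5 * p ≠ 41 * n) {e : ℕ → ℤ} (hE : typeExp 4 e = -8) (h2 : e 2 < 0)
    (he : ∀ k ≤ 4, netExp b (x + k * p) = e k) {g : ℚ} (hg : padicNorm p (gHat b p x - g) ≤ (p : ℚ) ^ (-(1 : ℤ))) :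
    padicNorm p ((p : ℚ) ^ 5 * classW b p x + g * typeW 4 e) ≤ (p : ℚ) ^ (-(1 : ℤ)) ∧
    padicNorm p ((p : ℚ) ^ 8 * classV b p x - g * typeV 4 e) ≤ (p : ℚ) ^ (-(1 : ℤ)) ∧
    padicNorm p (typeW 4 e) ≤ 1 ∧ padicNorm p (gHat b p x) ≤ 1 ∧
    padicNorm p (gHat b p (41 * n - (x + 4 * p)) + gHat b p x) ≤ (p : ℚ) ^ (-(1 : ℤ)) := by
  obtain ⟨hbox, -, -, hn⟩ := thmA_data b hb hwin
  have hp2 : p ≠ 2 := by omega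
  have hL : x + 4 * p ≤ (b 0).toNat := by rw [hN]; exact h4
  have hL' : (b 0).toNat < x + 4 * p + p := by rw [hN]; omega
  have hc : ¬ CentreIn b p x := hcen x hx hc4 hc5
  have hx0 : x ∈ classSet b p x := by simpa using level_mem b hx hL hL' (Nat.zero_le 4)
  have hw := w_digit_level b hx hL hL' hb hp5 hwin e he hc (i₀ := 2) (by norm_num) h2 hg
  have hv := v_digit_level b hx hL hL' hb hp5 hwin e he hc (i₀ := 2) (by norm_num) h2 hg
  have hgc := gHat_conj_level b hx hL hL' hb hp5 e he hc
  rw [hE] at hw hv hgc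
  rw [negp_zpow_five, show -(p : ℚ) ^ 5 * classW b p x - g * typeW 4 e = -((p : ℚ) ^ 5 * classW b p x + g * typeW 4 e)
    by ring, padicNorm.neg] at hw
  rw [negp_zpow_eight] at hv
  rw [neg_one_zpow_m7, neg_one_mul, sub_neg_eq_add, hN] at hgc
  refine ⟨hw, hv, ?_, padicNorm_gHat_le_one b hb hp5 hx hx0, hgc⟩
  rw [← wHat_level b hx hL hL' e he hc]
  exact padicNorm_wHat_le_one b hbox.1 hn hp2 x

include hp14 hp15 hp5 hb hwin hN hcen hT1 hT2 in
/-- **The digit package of a `MinT1`/`MinT2` pair** `x`, `x̄ = 41n − (x+4p)`: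
`p⁵(W_x + W_x̄) ≡ −α·ĝ_x`, `p⁸(V_x + V_x̄) ≡ β·ĝ_x (mod p)`, with the integrality of all four pieces, of `α`, and of `ĝ_x`. -/
theorem packT1 {x : ℕ} (hx : x ∈ MinT1 n p) :
    padicNorm p ((p : ℚ) ^ 5 * (classW b p x + classW b p (41 * n - (x + 4 * p))) + alphaD * gHat b p x) ≤
      (p : ℚ) ^ (-(1 : ℤ)) ∧
    padicNorm p ((p : ℚ) ^ 8 * (classV b p x + classV b p (41 * n - (x + 4 * p))) - betaD * gHat b p x) ≤
      (p : ℚ) ^ (-(1 : ℤ)) ∧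
    padicNorm p ((p : ℚ) ^ 5 * classW b p x) ≤ 1 ∧ padicNorm p ((p : ℚ) ^ 8 * classV b p x) ≤ 1 ∧
    padicNorm p ((p : ℚ) ^ 5 * classW b p (41 * n - (x + 4 * p))) ≤ 1 ∧
    padicNorm p ((p : ℚ) ^ 8 * classV b p (41 * n - (x + 4 * p))) ≤ 1 ∧
    padicNorm p alphaD ≤ 1 ∧ padicNorm p (gHat b p x) ≤ 1 := by
  have hx' := conj_mem_minT2 (n := n) (p := p) hx
  obtain ⟨e0, e1, e2, e3, e4⟩ := hT1 x hx
  obtain ⟨f0, f1, f2, f3, f4⟩ := hT2 _ hx'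
  rw [mem_minT1] at hx
  obtain ⟨hxp, h12, h27, h41⟩ := hx
  set g := gHat b p x with hgdef
  have hg0 : padicNorm p (gHat b p x - g) ≤ (p : ℚ) ^ (-(1 : ℤ)) := by
    rw [hgdef, sub_self, padicNorm.zero]; exact zpow_p_nonneg _
  obtain ⟨w1, v1, iw1, ig, hconj⟩ := digits_of_type hp5 b hb hwin hN hcen hxp (by omega) h41 (by omega)
    (by omega) typeExp_eT1 (by decide) (he_of_five e0 e1 e2 e3 e4) hg0
  have hg1 : padicNorm p (gHat b p (41 * n - (x + 4 * p)) - (-g)) ≤ (p : ℚ) ^ (-(1 : ℤ)) := by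
    rw [sub_neg_eq_add]; exact hconj
  obtain ⟨w2, v2, iw2, -, -⟩ := digits_of_type hp5 b hb hwin hN hcen (x := 41 * n - (x + 4 * p)) (by omega)
    (by omega) (by omega) (by omega) (by omega) typeExp_eT2 (by decide) (he_of_five f0 f1 f2 f3 f4) hg1
  have iα : padicNorm p alphaD ≤ 1 := nI_sub iw1 iw2
  refine ⟨?_, ?_, ?_, ?_, ?_, ?_, iα, ig⟩
  · have e : (p : ℚ) ^ 5 * (classW b p x + classW b p (41 * n - (x + 4 * p))) + alphaD * gHat b p x =
        ((p : ℚ) ^ 5 * classW b p x + g * typeW 4 eT1) +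
          ((p : ℚ) ^ 5 * classW b p (41 * n - (x + 4 * p)) + (-g) * typeW 4 eT2) := by rw [alphaD]; ring
    rw [e]; exact small_add w1 w2
  · have e : (p : ℚ) ^ 8 * (classV b p x + classV b p (41 * n - (x + 4 * p))) - betaD * gHat b p x =
        ((p : ℚ) ^ 8 * classV b p x - g * typeV 4 eT1) +
          ((p : ℚ) ^ 8 * classV b p (41 * n - (x + 4 * p)) - (-g) * typeV 4 eT2) := by rw [betaD]; ring
    rw [e]; exact small_add v1 v2
  · have e : (p : ℚ) ^ 5 * classW b p x = ((p : ℚ) ^ 5 * classW b p x + g * typeW 4 eT1) - g * typeW 4 eT1 := by ring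
    rw [e]; exact nI_sub (nI_of_small w1) (padicNorm_mul_le_one ig iw1)
  · have iv1 : padicNorm p (typeV 4 eT1) ≤ 1 := by
      obtain ⟨hbox, -, -, hn⟩ := thmA_data b hb hwin
      rw [← vHat_level b hxp (by rw [hN]; omega) (by rw [hN]; omega) eT1 (he_of_five e0 e1 e2 e3 e4)
        (hcen x hxp (by omega) (by omega))]
      exact padicNorm_vHat_le_one b hbox.1 hn (by omega)
    have e : (p : ℚ) ^ 8 * classV b p x = ((p : ℚ) ^ 8 * classV b p x - g * typeV 4 eT1) + g * typeV 4 eT1 := by ring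
    rw [e]; exact nI_add (nI_of_small v1) (padicNorm_mul_le_one ig iv1)
  · have e : (p : ℚ) ^ 5 * classW b p (41 * n - (x + 4 * p)) =
        ((p : ℚ) ^ 5 * classW b p (41 * n - (x + 4 * p)) + (-g) * typeW 4 eT2) + g * typeW 4 eT2 := by ring
    rw [e]; exact nI_add (nI_of_small w2) (padicNorm_mul_le_one ig iw2)
  · have iv2 : padicNorm p (typeV 4 eT2) ≤ 1 := by
      obtain ⟨hbox, -, -, hn⟩ := thmA_data b hb hwin
      rw [← vHat_level b (x := 41 * n - (x + 4 * p)) (by omega) (by rw [hN]; omega) (by rw [hN]; omega) eT2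
        (he_of_five f0 f1 f2 f3 f4) (hcen _ (by omega) (by omega) (by omega))]
      exact padicNorm_vHat_le_one b hbox.1 hn (by omega)
    have e : (p : ℚ) ^ 8 * classV b p (41 * n - (x + 4 * p)) =
        ((p : ℚ) ^ 8 * classV b p (41 * n - (x + 4 * p)) - (-g) * typeV 4 eT2) - g * typeV 4 eT2 := by ring
    rw [e]; exact nI_sub (nI_of_small v2) (padicNorm_mul_le_one ig iv2)

include hp14 hp15 hp5 hb hwin hN hcen hS in
/-- **The digit package of an `MinS` pair** `x`, `x̄ = 41n − (x+4p)` (both of the palindromic type `S`): the pair sums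
`p⁵(W_x + W_x̄)`, `p⁸(V_x + V_x̄)` VANISH modulo `p`; integrality of the pieces. -/
theorem packS {x : ℕ} (hx : x ∈ MinS n p) :
    padicNorm p ((p : ℚ) ^ 5 * (classW b p x + classW b p (41 * n - (x + 4 * p)))) ≤ (p : ℚ) ^ (-(1 : ℤ)) ∧
    padicNorm p ((p : ℚ) ^ 8 * (classV b p x + classV b p (41 * n - (x + 4 * p)))) ≤ (p : ℚ) ^ (-(1 : ℤ)) ∧
    padicNorm p ((p : ℚ) ^ 5 * classW b p x) ≤ 1 ∧ padicNorm p ((p : ℚ) ^ 8 * classV b p x) ≤ 1 := by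
  have hx' := conj_mem_minS (n := n) hp14 hx
  obtain ⟨e0, e1, e2, e3, e4⟩ := hS x hx
  obtain ⟨f0, f1, f2, f3, f4⟩ := hS _ hx'
  rw [mem_minS] at hx
  obtain ⟨hxp, h13, h28, hself⟩ := hx
  set g := gHat b p x with hgdef
  have hg0 : padicNorm p (gHat b p x - g) ≤ (p : ℚ) ^ (-(1 : ℤ)) := by
    rw [hgdef, sub_self, padicNorm.zero]; exact zpow_p_nonneg _
  obtain ⟨w1, v1, iw1, ig, hconj⟩ := digits_of_type hp5 b hb hwin hN hcen hxp (by omega) (by omega) hself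
    (by omega) typeExp_eS (by decide) (he_of_five e0 e1 e2 e3 e4) hg0
  have hg1 : padicNorm p (gHat b p (41 * n - (x + 4 * p)) - (-g)) ≤ (p : ℚ) ^ (-(1 : ℤ)) := by
    rw [sub_neg_eq_add]; exact hconj
  rw [mem_minS] at hx'
  obtain ⟨w2, v2, -, -, -⟩ := digits_of_type hp5 b hb hwin hN hcen (x := 41 * n - (x + 4 * p)) (by omega)
    (by omega) (by omega) hx'.2.2.2 (by omega) typeExp_eS (by decide) (he_of_five f0 f1 f2 f3 f4) hg1
  refine ⟨?_, ?_, ?_, ?_⟩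
  · have e : (p : ℚ) ^ 5 * (classW b p x + classW b p (41 * n - (x + 4 * p))) =
        ((p : ℚ) ^ 5 * classW b p x + g * typeW 4 eS) +
          ((p : ℚ) ^ 5 * classW b p (41 * n - (x + 4 * p)) + (-g) * typeW 4 eS) := by ring
    rw [e]; exact small_add w1 w2
  · have e : (p : ℚ) ^ 8 * (classV b p x + classV b p (41 * n - (x + 4 * p))) =
        ((p : ℚ) ^ 8 * classV b p x - g * typeV 4 eS) +
          ((p : ℚ) ^ 8 * classV b p (41 * n - (x + 4 * p)) - (-g) * typeV 4 eS) := by ring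
    rw [e]; exact small_add v1 v2
  · have e : (p : ℚ) ^ 5 * classW b p x = ((p : ℚ) ^ 5 * classW b p x + g * typeW 4 eS) - g * typeW 4 eS := by ring
    rw [e]; exact nI_sub (nI_of_small w1) (padicNorm_mul_le_one ig iw1)
  · have iv1 : padicNorm p (typeV 4 eS) ≤ 1 := by
      obtain ⟨hbox, -, -, hn⟩ := thmA_data b hb hwin
      rw [← vHat_level b hxp (by rw [hN]; omega) (by rw [hN]; omega) eS (he_of_five e0 e1 e2 e3 e4)
        (hcen x hxp hself (by omega))]
      exact padicNorm_vHat_le_one b hbox.1 hn (by omega)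
    have e : (p : ℚ) ^ 8 * classV b p x = ((p : ℚ) ^ 8 * classV b p x - g * typeV 4 eS) + g * typeV 4 eS := by ring
    rw [e]; exact nI_add (nI_of_small v1) (padicNorm_mul_le_one ig iv1)

end MinBlock

end Summit.KontsevichZagierPeriods.Zeta5Search.CellD

end
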